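import Mathlib
import HarnessLib
import Summits.HubbardSuperconductivity.HubbardSuperconductivity.Theorems.KLProgrammeKLRegimeEngineLastStepResponseBracketFlowFinalGraded
import Summits.HubbardSuperconductivity.HubbardSuperconductivity.Theorems.KLProgrammeKLRegimeEngineLastRespMomentsOfPosition
import Summits.HubbardSuperconductivity.HubbardSuperconductivity.Theorems.KLProgrammeKLRegimeEngineLastStepResponseInputs

/-!
# K3 gen-8-FLOW (stmt 20437, stub (C), located item #20, cure (δ′) «LAST-STEP SWAP», layer F3j″): THE #20 (δ′) DOOR WITH ITS E1 ROWS IN POSITION SPACE —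
# `lastResponse_bracket_flow_final_pos` (cell gate-hubbard-kl, seat p2 g21; pen (R220) GO «kernel-norm row ⟹ weighted ℓ¹ moment row»)

The graded door `lastResponse_bracket_flow_final_graded` (p646565) reads the four E1 rows `hMm_b hMs_b hMm_c hMs_c` as lattice moments of `𝔉⁻¹` of the two
momentum-space data (`klLocSelfEnergyRe`, odd Matsubara average) plus graded envelopes `hNm_X/hNs_X` and size rows `hZb/hZc`.  HERE those ten hypotheses
are replaced by the tower's currency (class-#7 shape): pinned, spatially weighted `L¹` norms of the trivial-multiplier two-leg POSITION kernel of the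
UNSEPARATED scale-`(N+1)` action at the last frame `K_{N+1}` (`N = n_β`),
* `hSb : ∀ m ≤ 4`, `hSbs` (order `s`): `ε·Σ_{x : x 0 = x₀} (1+|Δx̃₀|+|Δx̃₁|)^m·‖W₂(σ;x)‖ ≤ Sb m` (both spins, every pin);
* `hTc : ∀ m ≤ 4`, `hTcs`: the same with the TIME weight `ε·circDist_{2M}(t₀,t₁)` — `≤ Tc m`;
* graded coefficients `hNb : Sb j ≤ Nb·(4^N)^j`, `hNbs : Sbs ≤ Nbs·(4^N)^s`, `hNc`, `hNcs`; β-FREE size rows `hZb : 2·Nb·P₄ ≤ Zb·U`, `hZc : Nc·P₄ ≤ 16·Zc·U²`;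
* the smallness row `hCU` with `(2Nb, 2Nbs, Nc/16, Ncs/16)` in the slots of `(Nm_b, Ns_b, Nm_c, Ns_c)`.
Inside: `Mm_b := 2·Sb`, `Ms_b := 2·Sbs` (`TwoLegFourier.sum_momentWeight_norm_torusFourierInv_klLocSelfEnergyRe_le`), `Mm_c := 2(π/β)·Tc`, `Ms_c := 2(π/β)·Tcs`
(`…_oddAverage_le`), `Nm_c := Nc/(16·4^N)` (the ONE scale gain `2π/β ≤ 1/(16·4^N)`, `pi_div_le_Z_div_four_pow_nScales`), and the door's `hCU` follows from the β-free one by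
monotonicity.  WHAT E1 OWES after this file (last index): the four graded coefficients `Nb, Nbs` (∝ U), `Nc, Ncs` (∝ U²) — nothing else.

* **`lastResponse_bracket_flow_final_pos`**.

Composition only; no definitions; nothing asserts superconductivity.  Refs: BGM 2006 §2.1 (2.4)–(2.5), §2.3 (2.17)–(2.24), §2.4 Lemma 2.1 (2.36)–(2.42)
[cite: BenfattoGiulianiMastropietro2006]; FST 1996 §1 [cite: FeldmanSalmhoferTrubowitz1996].
-/

noncomputable section

namespace Summit.HubbardSuperconductivity.HubbardSuperconductivity.Theorems.EngineV8

set_option linter.dupNamespace false -- summit = problem name (single-conjunct summit), D-0017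
set_option exponentiation.threshold 512 -- the graded alias-tail constant is `2^282`

open Complex Real Finset Filter Literature.MathematicalPhysics.QuantumLattice Literature.Probability.LatticeModels
open Literature.MathematicalPhysics.QuantumLattice.BandSectorCounting
open Literature.Analysis.Fourier Literature.Analysis.Calculus
open Summit.HubbardSuperconductivity.HubbardSuperconductivity.Theorems.KLRegimeSplit
open Summit.HubbardSuperconductivity.HubbardSuperconductivity.Theorems.DispersionFlow
open Summit.HubbardSuperconductivity.HubbardSuperconductivity.Theorems.KLProgrammeLegKernels
open Summit.HubbardSuperconductivity.HubbardSuperconductivity.Theorems.PerturbedFermiCurve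
open scoped Nat

section FlowFinalPos

variable {L M : ℕ} [NeZero L] [NeZero M]

set_option maxHeartbeats 400000 in -- heartbeat disclosure (R137): ≈ 100-binder statement + the 34-argument call of the graded door (same class as `…FlowFinalGraded`; 200k whnf-times-out)
/-- **THE #20 (δ′) DOOR WITH ITS E1 ROWS IN POSITION SPACE** — see the module docstring.  Output = `(hRdiff, hR)` of `twoLegReadPriv_flow_succ_of_swap_lit`
at `n = nScales β` with `eR = fun k => if k = 0 then 0 else 1`, `eR' = fun k => if k = 0 then 1 else 0`. -/
theorem lastResponse_bracket_flow_final_pos {R : RenConsts} (hR : ∀ j, 0 ≤ R.Gfr j) {c : ℝ} (hc : 0 < c) (hcle : c ≤ klCurveC3 R)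
    {U : ℝ} (hU : 0 < U) (hU1 : U ≤ 1) (hUle : U ≤ klCurveU0 R) {β : ℝ} (hβmin : klBetaMin ≤ β) (hβc : β ≤ Real.exp (c / U ^ 2))
    {μ : ℝ} (hμ : μ ∈ klWindowC) (hK : FrameOK R U (nScales β) μ (klFlowFrameU L M β U μ (nScales β))) {G : GeoConsts} {Q : EngConsts} (hGS : ∀ k, 0 ≤ G.S k) (hQS : ∀ k, 0 ≤ Q.S' k) (hR0 : 0 < R.Gfr 0)
    (hPh : ∀ m ≤ nScales β, FlowPieceJetsAt L M β U μ R m) (hT : ∀ m ≤ nScales β, TwoLegReadJetsF L M G Q β U μ m) {W Ξ Θ : ℝ}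
    (hW : W = curveExtC (klChi2CauchyTab2 4) G.S 1 + curveExtC (klChi2CauchyTab2 4) Q.S' 1 * |U|) (hΞ : Ξ = 2 ^ 10 * (1 + Real.pi ^ 8 * (W * U ^ 2) / 2 ^ 11) + ∑ j ∈ range 5, R.Gfr j)
    (hΘ : Θ = 1 + ((∑ j ∈ range 5, R.Gfr j) + Real.pi ^ 8 * W / 2 ^ 11) * |U| / R.Gfr 0)
    (hdoor : R.Gfr 0 * |U| + ((∑ j ∈ range 5, R.Gfr j) + Real.pi ^ 8 * W / 2 ^ 11) * U ^ 2 ≤ 1 / 512) {P : SplitConsts} (hL : klEngL₄ P R β U ≤ L)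
    (hZn : IsUnit (effPartitionFn ℂ (normalCovariance L M (uvSymbolCT L M β μ (klFlowFrameU L M β U μ (nScales β + 1)) (klScale klE0 (nScales β + 1))))
      (hubbardInteraction L M β U + counterQuadratic L M β (klFlowFrameU L M β U μ (nScales β + 1)))))
    {Zb Zc Nb Nbs Nc Ncs : ℝ} (hZtU : 2 * (128 * (R.Gfr 0 + R.Gfr 1 + R.Gfr 2 + R.Gfr 3 + R.Gfr 4) * (1696963596321 + 925 * (10 ^ 14 * (1 + R.Gfr 3 + R.Gfr 4)))) * U ≤ 1)
    (hCU : 16 * (2 ^ 29 * (1 / 32) * (128 * (R.Gfr 0 + R.Gfr 1 + R.Gfr 2 + R.Gfr 3 + R.Gfr 4) * (1696963596321 + 925 * (10 ^ 14 * (1 + R.Gfr 3 + R.Gfr 4)))) ^ 3 * (1696963596321 +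
      925 * (10 ^ 14 * (1 + R.Gfr 3 + R.Gfr 4))) + 2 ^ 38 * (128 * (R.Gfr 0 + R.Gfr 1 + R.Gfr 2 + R.Gfr 3 + R.Gfr 4) * (1696963596321 + 925 * (10 ^ 14 * (1 + R.Gfr 3 + R.Gfr 4)))) ^ 2
      * Zb + 2 ^ 33 * (128 * (R.Gfr 0 + R.Gfr 1 + R.Gfr 2 + R.Gfr 3 + R.Gfr 4) * (1696963596321 + 925 * (10 ^ 14 * (1 + R.Gfr 3 + R.Gfr 4)))) * Zc + (klEngRsq R ^ 4 * (1696963596321 +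
      925 * (10 ^ 14 * (1 + R.Gfr 3 + R.Gfr 4))) / 2 ^ 30 + (2 * Nb * klEngRsq R ^ 4 / 2 ^ 6 + 2 * Nbs / 2 ^ 282) * (1696963596321 + 925 * (10 ^ 14 * (1 + R.Gfr 3 + R.Gfr 4))) / 2 ^ 13
      + (Nc / 16 * klEngRsq R ^ 4 / 2 ^ 6 + Ncs / 16 / 2 ^ 282) * (1696963596321 + 925 * (10 ^ 14 * (1 + R.Gfr 3 + R.Gfr 4))) / 2 ^ 13)) * U ≤ 1)
    {s : ℕ} (hs : 10 ≤ s)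
    {Sb : ℕ → ℝ} (hSb : ∀ m ≤ 4, ∀ (σ : Fin 2) (x₀ : SpaceTimeIdx L M), imagTimeWeight β M *
      ∑ x ∈ (univ : Finset (Fin 2 → SpaceTimeIdx L M)).filter (fun x => x 0 = x₀),
        (1 + ((((x 1).2 - (x 0).2) 0).valMinAbs.natAbs : ℝ) + ((((x 1).2 - (x 0).2) 1).valMinAbs.natAbs : ℝ)) ^ m *
          ‖sectorisedKernel L M β (trivialMultiplier L M) (klEffectiveAction L M β U μ (klFlowFrameU L M β U μ (nScales β + 1)) klE0 (nScales β + 1)) 2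
            (![((0, σ), 0), ((0, σ), 1)] : Fin 2 → SectorLeg 1) x‖ ≤ Sb m)
    {Sbs : ℝ} (hSbs : ∀ (σ : Fin 2) (x₀ : SpaceTimeIdx L M), imagTimeWeight β M *
      ∑ x ∈ (univ : Finset (Fin 2 → SpaceTimeIdx L M)).filter (fun x => x 0 = x₀),
        (1 + ((((x 1).2 - (x 0).2) 0).valMinAbs.natAbs : ℝ) + ((((x 1).2 - (x 0).2) 1).valMinAbs.natAbs : ℝ)) ^ s *
          ‖sectorisedKernel L M β (trivialMultiplier L M) (klEffectiveAction L M β U μ (klFlowFrameU L M β U μ (nScales β + 1)) klE0 (nScales β + 1)) 2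
            (![((0, σ), 0), ((0, σ), 1)] : Fin 2 → SectorLeg 1) x‖ ≤ Sbs)
    {Tc : ℕ → ℝ} (hTc : ∀ m ≤ 4, ∀ (σ : Fin 2) (x₀ : SpaceTimeIdx L M), imagTimeWeight β M *
      ∑ x ∈ (univ : Finset (Fin 2 → SpaceTimeIdx L M)).filter (fun x => x 0 = x₀),
        (1 + ((((x 1).2 - (x 0).2) 0).valMinAbs.natAbs : ℝ) + ((((x 1).2 - (x 0).2) 1).valMinAbs.natAbs : ℝ)) ^ m * (imagTimeWeight β M * (circDist (2 * M) (x 0).1.val (x 1).1.val : ℝ)) *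
          ‖sectorisedKernel L M β (trivialMultiplier L M) (klEffectiveAction L M β U μ (klFlowFrameU L M β U μ (nScales β + 1)) klE0 (nScales β + 1)) 2
            (![((0, σ), 0), ((0, σ), 1)] : Fin 2 → SectorLeg 1) x‖ ≤ Tc m)
    {Tcs : ℝ} (hTcs : ∀ (σ : Fin 2) (x₀ : SpaceTimeIdx L M), imagTimeWeight β M *
      ∑ x ∈ (univ : Finset (Fin 2 → SpaceTimeIdx L M)).filter (fun x => x 0 = x₀),
        (1 + ((((x 1).2 - (x 0).2) 0).valMinAbs.natAbs : ℝ) + ((((x 1).2 - (x 0).2) 1).valMinAbs.natAbs : ℝ)) ^ s * (imagTimeWeight β M * (circDist (2 * M) (x 0).1.val (x 1).1.val : ℝ)) *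
          ‖sectorisedKernel L M β (trivialMultiplier L M) (klEffectiveAction L M β U μ (klFlowFrameU L M β U μ (nScales β + 1)) klE0 (nScales β + 1)) 2
            (![((0, σ), 0), ((0, σ), 1)] : Fin 2 → SectorLeg 1) x‖ ≤ Tcs)
    (hZb : 2 * Nb * (1696963596321 + 925 * (10 ^ 14 * (1 + R.Gfr 3 + R.Gfr 4))) ≤ Zb * U) (hZc : Nc * (1696963596321 + 925 * (10 ^ 14 * (1 + R.Gfr 3 + R.Gfr 4))) ≤ 16 * Zc * U ^ 2)
    (hNb : ∀ j ≤ 4, Sb j ≤ Nb * ((4 : ℝ) ^ nScales β) ^ j) (hNbs : Sbs ≤ Nbs * ((4 : ℝ) ^ nScales β) ^ s)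
    (hNc : ∀ j ≤ 4, Tc j ≤ Nc * ((4 : ℝ) ^ nScales β) ^ j) (hNcs : Tcs ≤ Ncs * ((4 : ℝ) ^ nScales β) ^ s) :
    ContDiff ℝ 4 (fun θ : ℝ => (symInterp L (fun k => klLocSelfEnergyRe L M β U μ (klFlowFrameU L M β U μ (nScales β + 1)) (nScales β + 1) k -
            (klFlowFrameU L M β U μ (nScales β + 1)).eval (latticeMomentum L k))).eval (klFermiPoint μ (klFlowFrameU L M β U μ (nScales β)) θ) -
        (symInterp L (fun k => klLocSelfEnergyRe L M β U μ (klFlowFrameU L M β U μ (nScales β)) (nScales β + 1) k -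
            (klFlowFrameU L M β U μ (nScales β)).eval (latticeMomentum L k))).eval (klFermiPoint μ (klFlowFrameU L M β U μ (nScales β)) θ)) ∧
    ∀ k ≤ 4, ∀ θ : ℝ, |iteratedDeriv k (fun θ : ℝ => (symInterp L (fun k => klLocSelfEnergyRe L M β U μ (klFlowFrameU L M β U μ (nScales β + 1)) (nScales β + 1) k -
            (klFlowFrameU L M β U μ (nScales β + 1)).eval (latticeMomentum L k))).eval (klFermiPoint μ (klFlowFrameU L M β U μ (nScales β)) θ) -
        (symInterp L (fun k => klLocSelfEnergyRe L M β U μ (klFlowFrameU L M β U μ (nScales β)) (nScales β + 1) k -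
            (klFlowFrameU L M β U μ (nScales β)).eval (latticeMomentum L k))).eval (klFermiPoint μ (klFlowFrameU L M β U μ (nScales β)) θ)) θ| ≤
      curveJetBar (fun k => if k = 0 then 0 else 1) (fun k => if k = 0 then 1 else 0) U k (nScales β + 1)  := by
  have h128 : (128 : ℝ) ≤ β := by simpa [klBetaMin] using hβmin
  have hβ0 : (0 : ℝ) < β := by linarith
  have hl0 : (0 : ℝ) < (4 : ℝ) ^ nScales β := by positivity
  have hl1 : (1 : ℝ) ≤ (4 : ℝ) ^ nScales β := one_le_pow₀ (by norm_num)
  have hP40 : (0 : ℝ) < (1696963596321 + 925 * (10 ^ 14 * (1 + R.Gfr 3 + R.Gfr 4))) := by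
    have := hR 3; have := hR 4; positivity
  -- the four E1 rows from position space (…LastRespMomentsOfPosition)
  have hMmb : ∀ m ≤ 4, ∑ x : TorusSite 2 L, (1 + ((x 0).valMinAbs.natAbs : ℝ) + ((x 1).valMinAbs.natAbs : ℝ)) ^ m *
      ‖torusFourierInv (fun k => ((((fun k : TorusSite 2 L => klLocSelfEnergyRe L M β U μ (klFlowFrameU L M β U μ (nScales β + 1)) (nScales β + 1) k) k : ℝ)) : ℂ)) x‖ ≤ 2 * Sb m :=
    fun m hm => TwoLegFourier.sum_momentWeight_norm_torusFourierInv_klLocSelfEnergyRe_le hβ0 U μ (klFlowFrameU L M β U μ (nScales β + 1)) (nScales β + 1) m (hSb m hm)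
  have hMsb : ∑ x : TorusSite 2 L, (1 + ((x 0).valMinAbs.natAbs : ℝ) + ((x 1).valMinAbs.natAbs : ℝ)) ^ s *
      ‖torusFourierInv (fun k => ((((fun k : TorusSite 2 L => klLocSelfEnergyRe L M β U μ (klFlowFrameU L M β U μ (nScales β + 1)) (nScales β + 1) k) k : ℝ)) : ℂ)) x‖ ≤ 2 * Sbs :=
    TwoLegFourier.sum_momentWeight_norm_torusFourierInv_klLocSelfEnergyRe_le hβ0 U μ (klFlowFrameU L M β U μ (nScales β + 1)) (nScales β + 1) s hSbs
  have hMmc : ∀ m ≤ 4, ∑ x : TorusSite 2 L, (1 + ((x 0).valMinAbs.natAbs : ℝ) + ((x 1).valMinAbs.natAbs : ℝ)) ^ m *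
      ‖torusFourierInv (fun k => ((((fun k : TorusSite 2 L => (∑ s : Fin 2, ((klSelfEnergy L M β U μ (klFlowFrameU L M β U μ (nScales β + 1)) klE0 (nScales β + 1) (omega0 M, k) s).im -
          (klSelfEnergy L M β U μ (klFlowFrameU L M β U μ (nScales β + 1)) klE0 (nScales β + 1) ((omega0 M).rev, k) s).im)) / 4) k : ℝ)) : ℂ)) x‖ ≤ 2 * (Real.pi / β) * Tc m :=
    fun m hm => TwoLegFourier.sum_momentWeight_norm_torusFourierInv_oddAverage_le hβ0 U μ (klFlowFrameU L M β U μ (nScales β + 1)) (nScales β + 1) m (hTc m hm)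
  have hMsc : ∑ x : TorusSite 2 L, (1 + ((x 0).valMinAbs.natAbs : ℝ) + ((x 1).valMinAbs.natAbs : ℝ)) ^ s *
      ‖torusFourierInv (fun k => ((((fun k : TorusSite 2 L => (∑ s : Fin 2, ((klSelfEnergy L M β U μ (klFlowFrameU L M β U μ (nScales β + 1)) klE0 (nScales β + 1) (omega0 M, k) s).im -
          (klSelfEnergy L M β U μ (klFlowFrameU L M β U μ (nScales β + 1)) klE0 (nScales β + 1) ((omega0 M).rev, k) s).im)) / 4) k : ℝ)) : ℂ)) x‖ ≤ 2 * (Real.pi / β) * Tcs :=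
    TwoLegFourier.sum_momentWeight_norm_torusFourierInv_oddAverage_le hβ0 U μ (klFlowFrameU L M β U μ (nScales β + 1)) (nScales β + 1) s hTcs
  -- the graded envelopes of the door
  have hgain : 2 * (Real.pi / β) ≤ 1 / (16 * (4 : ℝ) ^ nScales β) := by
    have h := pi_div_le_Z_div_four_pow_nScales hβmin (Z := 1 / 32) le_rfl
    rw [show 1 / (16 * (4 : ℝ) ^ nScales β) = 2 * (1 / 32 / (4 : ℝ) ^ nScales β) by field_simp; norm_num]
    linarith
  have hε : 0 ≤ imagTimeWeight β M := imagTimeWeight_nonneg hβ0.le M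
  have hTc0 : ∀ m ≤ 4, 0 ≤ Tc m := fun m hm => le_trans (mul_nonneg hε
    (Finset.sum_nonneg fun x _ => mul_nonneg (mul_nonneg (by positivity) (mul_nonneg hε (Nat.cast_nonneg _))) (norm_nonneg _))) (hTc m hm 0 (omega0 M, 0))
  have hTcs0 : 0 ≤ Tcs := le_trans (mul_nonneg hε
    (Finset.sum_nonneg fun x _ => mul_nonneg (mul_nonneg (by positivity) (mul_nonneg hε (Nat.cast_nonneg _))) (norm_nonneg _))) (hTcs 0 (omega0 M, 0))
  have hNc0 : 0 ≤ Nc := by have h := hNc 0 (by norm_num); rw [pow_zero, mul_one] at h; exact (hTc0 0 (by norm_num)).trans h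
  have hNcs0 : 0 ≤ Ncs := nonneg_of_le_mul_pow hTcs0 hl1 hNcs
  have hNmb' : ∀ j ≤ 4, 2 * Sb j ≤ 2 * Nb * ((4 : ℝ) ^ nScales β) ^ j := fun j hj =>
    (mul_le_mul_of_nonneg_left (hNb j hj) zero_le_two).trans_eq (by ring)
  have hNsb' : 2 * Sbs ≤ 2 * Nbs * ((4 : ℝ) ^ nScales β) ^ s := (mul_le_mul_of_nonneg_left hNbs zero_le_two).trans_eq (by ring)
  have hNmc' : ∀ j ≤ 4, 2 * (Real.pi / β) * Tc j ≤ Nc / (16 * (4 : ℝ) ^ nScales β) * ((4 : ℝ) ^ nScales β) ^ j := fun j hj => by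
    have h1 : 2 * (Real.pi / β) * Tc j ≤ 1 / (16 * (4 : ℝ) ^ nScales β) * Tc j := mul_le_mul_of_nonneg_right hgain (hTc0 j hj)
    have h2 : 1 / (16 * (4 : ℝ) ^ nScales β) * Tc j ≤ 1 / (16 * (4 : ℝ) ^ nScales β) * (Nc * ((4 : ℝ) ^ nScales β) ^ j) :=
      mul_le_mul_of_nonneg_left (hNc j hj) (by positivity)
    calc 2 * (Real.pi / β) * Tc j ≤ 1 / (16 * (4 : ℝ) ^ nScales β) * (Nc * ((4 : ℝ) ^ nScales β) ^ j) := h1.trans h2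
      _ = Nc / (16 * (4 : ℝ) ^ nScales β) * ((4 : ℝ) ^ nScales β) ^ j := by ring
  have hNsc' : 2 * (Real.pi / β) * Tcs ≤ Ncs / (16 * (4 : ℝ) ^ nScales β) * ((4 : ℝ) ^ nScales β) ^ s := by
    have h1 : 2 * (Real.pi / β) * Tcs ≤ 1 / (16 * (4 : ℝ) ^ nScales β) * Tcs := mul_le_mul_of_nonneg_right hgain hTcs0
    have h2 : 1 / (16 * (4 : ℝ) ^ nScales β) * Tcs ≤ 1 / (16 * (4 : ℝ) ^ nScales β) * (Ncs * ((4 : ℝ) ^ nScales β) ^ s) :=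
      mul_le_mul_of_nonneg_left hNcs (by positivity)
    calc 2 * (Real.pi / β) * Tcs ≤ 1 / (16 * (4 : ℝ) ^ nScales β) * (Ncs * ((4 : ℝ) ^ nScales β) ^ s) := h1.trans h2
      _ = Ncs / (16 * (4 : ℝ) ^ nScales β) * ((4 : ℝ) ^ nScales β) ^ s := by ring
  -- the size rows
  have hZc' : Nc / (16 * (4 : ℝ) ^ nScales β) * (1696963596321 + 925 * (10 ^ 14 * (1 + R.Gfr 3 + R.Gfr 4))) * (4 : ℝ) ^ nScales β ≤ Zc * U ^ 2 := by
    have e : Nc / (16 * (4 : ℝ) ^ nScales β) * (1696963596321 + 925 * (10 ^ 14 * (1 + R.Gfr 3 + R.Gfr 4))) * (4 : ℝ) ^ nScales β = Nc * (1696963596321 + 925 * (10 ^ 14 * (1 + R.Gfr 3 + R.Gfr 4))) / 16 := by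
      field_simp
    rw [e, div_le_iff₀ (by norm_num : (0:ℝ) < 16)]
    linarith
  -- the smallness row at the instantiated sizes (monotone in the `c` coefficients: `1/(16·4^N) ≤ 1/16`)
  have h16 : (16 : ℝ) ≤ 16 * (4 : ℝ) ^ nScales β := le_mul_of_one_le_right (by norm_num) hl1
  have hcdiv : Nc / (16 * (4 : ℝ) ^ nScales β) ≤ Nc / 16 := div_le_div_of_nonneg_left hNc0 (by norm_num) h16
  have hcsdiv : Ncs / (16 * (4 : ℝ) ^ nScales β) ≤ Ncs / 16 := div_le_div_of_nonneg_left hNcs0 (by norm_num) h16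
  have hCU' : 16 * (2 ^ 29 * (1 / 32) * (128 * (R.Gfr 0 + R.Gfr 1 + R.Gfr 2 + R.Gfr 3 + R.Gfr 4) * (1696963596321 + 925 * (10 ^ 14 * (1 + R.Gfr 3 + R.Gfr 4)))) ^ 3 * (1696963596321 +
      925 * (10 ^ 14 * (1 + R.Gfr 3 + R.Gfr 4))) + 2 ^ 38 * (128 * (R.Gfr 0 + R.Gfr 1 + R.Gfr 2 + R.Gfr 3 + R.Gfr 4) * (1696963596321 + 925 * (10 ^ 14 * (1 + R.Gfr 3 + R.Gfr
      4)))) ^ 2 * Zb + 2 ^ 33 * (128 * (R.Gfr 0 + R.Gfr 1 + R.Gfr 2 + R.Gfr 3 + R.Gfr 4) * (1696963596321 + 925 * (10 ^ 14 * (1 + R.Gfr 3 + R.Gfr 4)))) * Zc + (klEngRsq R ^ 4 *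
      (1696963596321 + 925 * (10 ^ 14 * (1 + R.Gfr 3 + R.Gfr 4))) / 2 ^ 30 + (2 * Nb * klEngRsq R ^ 4 / 2 ^ 6 + 2 * Nbs / 2 ^ 282) * (1696963596321 + 925 * (10 ^ 14 * (1 +
      R.Gfr 3 + R.Gfr 4))) / 2 ^ 13 + (Nc / (16 * (4 : ℝ) ^ nScales β) * klEngRsq R ^ 4 / 2 ^ 6 + Ncs / (16 * (4 : ℝ) ^ nScales β) / 2 ^ 282) * (1696963596321 + 925 * (10 ^ 14
      * (1 + R.Gfr 3 + R.Gfr 4))) / 2 ^ 13)) * U ≤ 1 := by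
    refine le_trans ?_ hCU
    have hU0 : 0 ≤ U := hU.le
    have hRsq : 0 ≤ klEngRsq R ^ 4 := pow_nonneg (klEngRsq_pos R).le 4
    gcongr
  exact lastResponse_bracket_flow_final_graded hR hc hcle hU hU1 hUle hβmin hβc hμ hK hGS hQS hR0 hPh hT hW hΞ hΘ hdoor hL hZn hZtU hCU' hs hMmb hMsb hMmc hMsc
    hZb hZc' hNmb' hNsb' hNmc' hNsc'

end FlowFinalPos

end Summit.HubbardSuperconductivity.HubbardSuperconductivity.Theorems.EngineV8

end
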